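import Summits.QuantumAdvantage.AdviceFreeQNC0.AffBells25RigidityChain
import Summits.QuantumAdvantage.AdviceFreeQNC0.KernelFibration
import Mathlib.InformationTheory.Hamming
import HarnessLib

/-!
# Theorem B′ chain, part 3: the covering lemma (L5), the domination count (L6), parity halves

Prover seat qn-prover-3 g14 (ask P-25 of planner qn-p1 g25, ROUND-24 §2.10 (c), (d)).  Pure hypercube
combinatorics on `Fin Z → Bool` (neighbours `nbr e u = u` with bit `e` flipped), independent of the `𝔽₄` part:

* **`coveringLemma : CoveringLemma`** (L5): `Z ≥ 5`, `U` nonempty, closed under complement, and no vertex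
  outside `U` with exactly one neighbour in `U` ⇒ `#U ≥ Z + 2`.  Proof: fix `u ∈ U`; for every direction `e`
  there is a point of `U` at Hamming distance `1` or `2` from `u` that differs from `u` at `e` (either `u^e ∈ U`,
  or `u^e ∉ U` has `u` as a `U`-neighbour, hence a second one `u^{e,e'}`); a point at distance `≤ 2` serves at
  most `2` directions, so `U` has `≥ Z/2` points in the punctured `2`-ball of `u`, likewise of `ū ∈ U`; for
  `Z ≥ 5` the two balls and `{u, ū}` are pairwise disjoint (`hammingDist u ū = Z`), so `2·#U ≥ 2Z + 4`.
* **`dominationCount : DominationCount`** (L6): if every point of `W ∖ U` has a neighbour in `U` then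
  `#W ≤ (Z+1)·#U` (`W ⊆ U ∪ N(U)`).
* `card_parityClass`: each parity class has `2^{Z−1}` points (`Z ≥ 1`; one-coin involution,
  `Fib19.two_mul_card_filter_of_invol`).

WHAT THIS IS NOT: instrument for the (NP₀) rung of crux stmt-QuantumAdvantage-22907 (route DWalkThree); no route item;
separation NOT moved.
-/

namespace Summit.QuantumAdvantage.AdviceFreeQNC0

namespace AffBells25L

open Finset AffBells24

variable {Z : ℕ}

/-! ### Neighbours and Hamming distance -/

/-- The flipped bit. -/
theorem nbr_apply_self (e : Fin Z) (u : Fin Z → Bool) : nbr e u e = !u e := by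
  unfold nbr; rw [Function.update_self]

/-- The other bits are unchanged. -/
theorem nbr_apply_of_ne {e e' : Fin Z} (h : e' ≠ e) (u : Fin Z → Bool) : nbr e u e' = u e' := by
  unfold nbr; rw [Function.update_of_ne h]

/-- Flipping twice is the identity. -/
theorem nbr_nbr (e : Fin Z) (u : Fin Z → Bool) : nbr e (nbr e u) = u := by
  funext e'
  by_cases h : e' = e
  · subst h; rw [nbr_apply_self, nbr_apply_self, Bool.not_not]
  · rw [nbr_apply_of_ne h, nbr_apply_of_ne h]

/-- A neighbour is at Hamming distance `1`. -/
theorem hammingDist_nbr (e : Fin Z) (u : Fin Z → Bool) : hammingDist u (nbr e u) = 1 := by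
  unfold hammingDist
  rw [card_eq_one]
  refine ⟨e, ?_⟩
  ext e'
  rw [mem_filter, mem_singleton]
  simp only [mem_univ, true_and]
  by_cases h : e' = e
  · subst h; rw [nbr_apply_self]; simp
  · rw [nbr_apply_of_ne h]; simp [h]

/-- A second flip at a different coordinate gives Hamming distance `2`. -/
theorem hammingDist_nbr_nbr {e e' : Fin Z} (h : e' ≠ e) (u : Fin Z → Bool) :
    hammingDist u (nbr e' (nbr e u)) = 2 := by
  unfold hammingDist
  rw [card_eq_two]
  refine ⟨e, e', h.symm, ?_⟩
  ext d
  rw [mem_filter, mem_insert, mem_singleton]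
  simp only [mem_univ, true_and]
  by_cases hd : d = e'
  · subst hd; rw [nbr_apply_self, nbr_apply_of_ne h]; simp
  · rw [nbr_apply_of_ne hd]
    by_cases hd' : d = e
    · subst hd'; rw [nbr_apply_self]; simp
    · rw [nbr_apply_of_ne hd']; simp [hd, hd']

/-- The complement is at Hamming distance `Z`. -/
theorem hammingDist_compl (u : Fin Z → Bool) : hammingDist u (fun e => !u e) = Z := by
  unfold hammingDist
  rw [filter_true_of_mem fun e _ => ?_, card_univ, Fintype.card_fin]
  show u e ≠ !u e
  cases u e <;> decide

/-- The fibre bound: the directions `e` at which `q` differs from `u` number `hammingDist u q`. -/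
theorem card_filter_apply_ne (u q : Fin Z → Bool) :
    (univ.filter fun e => q e ≠ u e).card = hammingDist u q := by
  unfold hammingDist
  congr 1
  ext e
  simp only [mem_filter, mem_univ, true_and]
  exact ne_comm

/-! ### (L5) the covering lemma -/

/-- The local step: around `u ∈ U`, every direction `e` is served by a point of `U` at distance `1` or `2` from `u`
that differs from `u` at `e`. -/
theorem exists_server (U : Finset (Fin Z → Bool)) (hU : ∀ v ∉ U, (univ.filter fun e => nbr e v ∈ U).card ≠ 1)
    {u : Fin Z → Bool} (hu : u ∈ U) (e : Fin Z) :
    ∃ q ∈ U, q e ≠ u e ∧ 1 ≤ hammingDist u q ∧ hammingDist u q ≤ 2 := by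
  by_cases h : nbr e u ∈ U
  · refine ⟨nbr e u, h, ?_, ?_, ?_⟩
    · rw [nbr_apply_self]; cases u e <;> simp
    · rw [hammingDist_nbr]
    · rw [hammingDist_nbr]; norm_num
  · -- `v = u^e ∉ U` has the `U`-neighbour `u`, hence (card ≠ 1) a second one `v^{e'}`, `e' ≠ e`
    set v := nbr e u with hv
    have he : e ∈ univ.filter fun d => nbr d v ∈ U := by
      rw [mem_filter, hv, nbr_nbr]; exact ⟨mem_univ _, hu⟩
    have hcard : 1 < (univ.filter fun d => nbr d v ∈ U).card := by
      have h1 : 1 ≤ (univ.filter fun d => nbr d v ∈ U).card := card_pos.mpr ⟨e, he⟩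
      have h2 := hU v h
      omega
    obtain ⟨e', he', hne⟩ := exists_mem_ne hcard e
    rw [mem_filter] at he'
    refine ⟨nbr e' v, he'.2, ?_, ?_, ?_⟩
    · rw [nbr_apply_of_ne hne.symm, hv, nbr_apply_self]; cases u e <;> simp
    · rw [hv, hammingDist_nbr_nbr hne]; norm_num
    · rw [hv, hammingDist_nbr_nbr hne]

/-- The punctured `2`-ball count: around `u ∈ U`, `Z ≤ 2 · #{q ∈ U : 1 ≤ d(u,q) ≤ 2}`. -/
theorem le_two_mul_card_ball (U : Finset (Fin Z → Bool))
    (hU : ∀ v ∉ U, (univ.filter fun e => nbr e v ∈ U).card ≠ 1) {u : Fin Z → Bool} (hu : u ∈ U) :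
    Z ≤ 2 * (U.filter fun q => 1 ≤ hammingDist u q ∧ hammingDist u q ≤ 2).card := by
  classical
  choose p hpU hpe hpd1 hpd2 using exists_server U hU hu
  have himg : (univ : Finset (Fin Z)).image p ⊆ U.filter fun q => 1 ≤ hammingDist u q ∧ hammingDist u q ≤ 2 := by
    intro q hq
    rw [mem_image] at hq
    obtain ⟨e, -, rfl⟩ := hq
    rw [mem_filter]
    exact ⟨hpU e, hpd1 e, hpd2 e⟩
  have hfib : (univ : Finset (Fin Z)).card ≤ 2 * ((univ : Finset (Fin Z)).image p).card := by
    refine card_le_mul_card_image univ 2 fun q hq => ?_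
    rw [mem_image] at hq
    obtain ⟨e₀, -, rfl⟩ := hq
    calc (univ.filter fun e => p e = p e₀).card
        ≤ (univ.filter fun e => (p e₀) e ≠ u e).card := by
          refine card_le_card fun e he => ?_
          rw [mem_filter] at he ⊢
          refine ⟨mem_univ _, ?_⟩
          rw [← he.2]; exact hpe e
      _ = hammingDist u (p e₀) := card_filter_apply_ne u (p e₀)
      _ ≤ 2 := hpd2 e₀
  rw [card_univ, Fintype.card_fin] at hfib
  exact hfib.trans (Nat.mul_le_mul_left 2 (card_le_card himg))

/-- **(L5)** COVERING LEMMA: `Z ≥ 5`, `U` nonempty, closed under complement, no outside vertex with exactly one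
`U`-neighbour ⇒ `#U ≥ Z + 2`. -/
theorem coveringLemma : CoveringLemma := by
  classical
  intro Z U hZ hne hcompl hU
  obtain ⟨u, hu⟩ := hne
  set ubar : Fin Z → Bool := fun e => !u e with hubar
  have hubarU : ubar ∈ U := hcompl u hu
  -- the two punctured balls
  set A := U.filter fun q => 1 ≤ hammingDist u q ∧ hammingDist u q ≤ 2 with hA
  set B := U.filter fun q => 1 ≤ hammingDist ubar q ∧ hammingDist ubar q ≤ 2 with hB
  have hAZ : Z ≤ 2 * A.card := le_two_mul_card_ball U hU hu
  have hBZ : Z ≤ 2 * B.card := le_two_mul_card_ball U hU hubarU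
  have hduu : hammingDist u ubar = Z := hammingDist_compl u
  -- disjointness
  have hAB : Disjoint A B := by
    rw [disjoint_left]
    intro q hqA hqB
    rw [hA, mem_filter] at hqA
    rw [hB, mem_filter] at hqB
    have htri := hammingDist_triangle u q ubar
    rw [hammingDist_comm q ubar] at htri
    omega
  have huA : u ∉ A ∪ B := by
    rw [mem_union, hA, hB, mem_filter, mem_filter, hammingDist_self, hammingDist_comm, hduu]
    omega
  have hubarAB : ubar ∉ A ∪ B := by
    rw [mem_union, hA, hB, mem_filter, mem_filter, hammingDist_self, hduu]
    omega
  have huubar : u ≠ ubar := by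
    intro h
    have := hammingDist_self u
    rw [h] at hduu
    rw [hammingDist_self] at hduu
    omega
  -- the count
  have hsub : insert u (insert ubar (A ∪ B)) ⊆ U := by
    intro q hq
    rw [mem_insert, mem_insert, mem_union] at hq
    rcases hq with rfl | rfl | hq | hq
    · exact hu
    · exact hubarU
    · exact (mem_filter.1 hq).1
    · exact (mem_filter.1 hq).1
  have hcard : (insert u (insert ubar (A ∪ B))).card = A.card + B.card + 2 := by
    rw [card_insert_of_notMem, card_insert_of_notMem hubarAB, card_union_of_disjoint hAB]
    rw [mem_insert, not_or]
    exact ⟨huubar, huA⟩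
  have := card_le_card hsub
  omega

/-! ### (L6) the domination count -/

/-- **(L6)** DOMINATION COUNT: if every point of `W ∖ U` has a neighbour in `U` then `#W ≤ (Z+1)·#U`. -/
theorem dominationCount : DominationCount := by
  classical
  intro Z U W hdom
  have hsub : W ⊆ U ∪ U.biUnion fun u => (univ : Finset (Fin Z)).image fun e => nbr e u := by
    intro w hw
    rw [mem_union]
    by_cases hwU : w ∈ U
    · exact Or.inl hwU
    · right
      obtain ⟨e, he⟩ := hdom w hw hwU
      rw [mem_biUnion]
      refine ⟨nbr e w, he, ?_⟩
      rw [mem_image]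
      exact ⟨e, mem_univ _, nbr_nbr e w⟩
  calc W.card ≤ (U ∪ U.biUnion fun u => (univ : Finset (Fin Z)).image fun e => nbr e u).card := card_le_card hsub
    _ ≤ U.card + (U.biUnion fun u => (univ : Finset (Fin Z)).image fun e => nbr e u).card := card_union_le _ _
    _ ≤ U.card + U.card * Z := by
        refine Nat.add_le_add_left (card_biUnion_le_card_mul U _ Z fun u _ => ?_) _
        exact card_image_le.trans (by rw [card_univ, Fintype.card_fin])
    _ = (Z + 1) * U.card := by ring

/-! ### Parity halves -/

/-- Each parity class is half the cube: `#P_σ = 2^{Z-1}` for `Z ≥ 1`. -/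
theorem card_parityClass (hZ : 1 ≤ Z) (σ : ℕ) : (parityClass Z σ).card = 2 ^ (Z - 1) := by
  classical
  have e0 : Fin Z := ⟨0, hZ⟩
  have h := Fib19.two_mul_card_filter_of_invol (univ : Finset (Fin Z → Bool))
    (fun y => (univ.filter fun e => y e = true).card % 2 = σ % 2) (fun y => nbr e0 y) (fun y _ => mem_univ _)
    (fun y _ => nbr_nbr e0 y) (fun y _ => ?_)
  · unfold parityClass
    rw [card_univ, Fintype.card_fun, Fintype.card_bool, Fintype.card_fin] at h
    have h2 : 2 ^ Z = 2 * 2 ^ (Z - 1) := by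
      rw [← pow_succ']; congr 1; omega
    rw [h2] at h
    exact Nat.eq_of_mul_eq_mul_left two_pos h
  · -- flipping one coin changes the parity of the number of ones
    have key : ∀ y : Fin Z → Bool, y e0 = false →
        (univ.filter fun e => nbr e0 y e = true).card = (univ.filter fun e => y e = true).card + 1 := by
      intro y hy
      have : (univ.filter fun e => nbr e0 y e = true) = insert e0 (univ.filter fun e => y e = true) := by
        ext e
        rw [mem_insert, mem_filter, mem_filter]
        simp only [mem_univ, true_and]
        by_cases he : e = e0
        · subst he; rw [nbr_apply_self, hy]; simp
        · rw [nbr_apply_of_ne he]; simp [he]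
      rw [this, card_insert_of_notMem]
      rw [mem_filter, hy]; simp
    cases hy : y e0
    · rw [key y hy]; omega
    · have hy' : nbr e0 y e0 = false := by rw [nbr_apply_self, hy]; rfl
      have := key (nbr e0 y) hy'
      rw [nbr_nbr] at this
      rw [this]; omega

end AffBells25L

end Summit.QuantumAdvantage.AdviceFreeQNC0
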